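import Summits.BirchSwinnertonDyer.BirchSwinnertonDyer.Theorems.EisensteinPrimesX2AnalyticLambdaResultantCertificate
import Summits.BirchSwinnertonDyer.BirchSwinnertonDyer.Theorems.EisensteinPrimesX2LambdaCountAtPair
import HarnessLib

/-!
# Route `EisensteinPrimes`, line `mudescent`, crux 3 `MazurMCOnCellB`: stubs 3 + 4 at a pair, Mazur's
# main conjecture at the pair and the END-TO-END certificate at a type-A split étale end FROM ONE
# RATIONAL RESULTANT (helper; closes nothing)

Seat `bsd-eis-lam-a` g4 (PROGRAMME PART 1b, ACCEL-LIST (4); items stmt-BirchSwinnertonDyer-19033 /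
-19035; skeleton owner bsd-eis-ky). Companion of `EisensteinPrimesX2AnalyticLambdaResultantCertificate`
(this seat: `R_{n+1} := Res(Φ_{pⁿ⁺¹}(X+1), θ_{n+1}(f)) ∈ ℚ`, `R ≠ 0`,
`φ(pⁿ⁺¹)·v_p(ϖ) + v_p(R) = V < φ(pⁿ⁺¹)` ⟹ `X2.AnalyticMuLE W p 0 ∧ X2.AnalyticLambdaEq W p V` at a
reducible multiplicative odd `p`, `L`-free and `G`-free) composed with g3's
`EisensteinPrimesX2LambdaCountAtPair` (route T / slack / rank growth / lam-b's split-torsion budget)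
exactly as g3's `EisensteinPrimesX2LambdaCountFromRiemannSums` §2 did for ONE Birch sum.

HONEST FRAMING. THEOREMS ONLY — no definition, no new named fact; nothing about any particular curve
is asserted (the resultant valuation and the integers are hypotheses an instrument's exact modular
symbol table is EVIDENCE for); closes nothing; moves no label. Class-wide the stub stays crux-sized
(lam-a g0/g2). Per pair, the whole analytic side of the line `mudescent` at a type-A étale end is
now ONE rational determinant:

* `lambdaCount_of_padicValRat_resultant_eq_of_algebraicLambdaGE` — + `AlgebraicLambdaGE W₀ p k`,
  `V ≤ k + e` ⟹ `X2.AnalyticMuLE W₀ p 0` and the registered conclusion of `stub_lambdaCount_offLocus`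
  at `W₀` verbatim;
* `mazurMainConjectureAt_of_padicValRat_resultant_eq_of_algebraicLambdaGE` (+ `_of_le` slack,
  + `_of_layerRankGEAt` rank growth) — Mazur's main conjecture at the pair;
* `X2.mazurMainConjectureAt_of_padicValRat_resultant_eq_of_dvd_torsionOrder_of_dvd_localTamagawaNumber`
  — END-TO-END at a type-A SPLIT étale end: `p ∣ #E(ℚ)_tors`, `S` Tamagawa places,
  `V + 2·v_p(#E(ℚ)_tors) ≤ #S + 2` ⟹ `X2.MazurMainConjectureAt W₀ p`, named print `hWu`, `hPT`,
  `h415`, `hpar` (lam-b p480562).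

References: [GreenbergLNM1716] §5 pp. 114–118, Cor. 5.6 (p. 136), Thm. 1.9, Prop. 3.10;
[Wuthrich2014] Thm. 16; [MazurTateTeitelbaum1986Invent] §I.13–I.15; [Washington1997] §7.1–7.2.
-/

set_option linter.dupNamespace false
set_option autoImplicit false

noncomputable section

open scoped Classical MatrixGroups ModularForm

open CongruenceSubgroup WeierstrassCurve NumberField IsDedekindDomain
  Literature.NumberTheory.EllipticCurves
  Literature.NumberTheory.EllipticCurves.ModularForms
  Literature.NumberTheory.EllipticCurves.Rank1Residual
  Literature.NumberTheory.EllipticCurves.GreenbergVatsal2000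
  Literature.NumberTheory.EllipticCurves.Greenberg1999
  Literature.NumberTheory.EllipticCurves.Wuthrich2014
  Literature.NumberTheory.GaloisCohomology
  Summit.BirchSwinnertonDyer.Rank1Residual
  Summit.BirchSwinnertonDyer.Rank1Residual.X1.MuLambda
  Summit.BirchSwinnertonDyer.Rank1Residual.X1.TamagawaSqueeze
  Summit.BirchSwinnertonDyer.Rank1Residual.Iwasawa
  Summit.BirchSwinnertonDyer.BirchSwinnertonDyer.Theorems.EisensteinPrimesX2AnalyticLambdaCertificate
  Summit.BirchSwinnertonDyer.BirchSwinnertonDyer.Theorems.EisensteinPrimesX2LambdaCountAtPair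
  Summit.BirchSwinnertonDyer.BirchSwinnertonDyer.Theorems.EisensteinPrimesX2AnalyticLambdaResultantCertificate

namespace Summit.BirchSwinnertonDyer.BirchSwinnertonDyer.Theorems.EisensteinPrimesX2LambdaCountFromResultant

variable {p : ℕ} [hp : Fact p.Prime]

section AtPair

variable {W : WeierstrassCurve ℚ} [W.IsElliptic] [W.IsGloballyMinimal]
  {N : ℕ} [NeZero N] {f : CuspForm (Gamma0 N) 2} {ϖ : ℚ}

/-- **Stubs 3 and 4 of `mudescent` AT A PAIR from the resultant certificate and an algebraic
budget**: the `padicValRat` certificate of layer `n + 1` with value `V`, `AlgebraicLambdaGE W₀ p k`,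
`V ≤ k` (non-split) / `V ≤ k + 1` (split) ⟹ `X2.AnalyticMuLE W₀ p 0` and the registered conclusion
of `stub_lambdaCount_offLocus` at `W₀` verbatim. [cite: GreenbergVatsal2000, p. 2–3, (1)–(2)]
[cite: Wuthrich2014, Thm. 16 (p. 397)] -/
theorem lambdaCount_of_padicValRat_resultant_eq_of_algebraicLambdaGE
    (hWu : thm16_charIdeal_dvd_multiplicative_of_reducible) (hpar : nonempty_modularParametrizationData)
    (hp2 : p ≠ 2) (hmult : W.HasMultiplicativeReductionAtPrime p)
    (hred : ¬ W.HasIrreducibleModPGaloisRep p) (hf : IsNewformOf W f)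
    (hϖ : (ϖ : ℝ) * W.realPeriodRat = plusPeriod f) {n V : ℕ} (hV : V < Nat.totient (p ^ (n + 1)))
    (hR : Polynomial.resultant ((Polynomial.cyclotomic (p ^ (n + 1)) ℚ).comp (Polynomial.X + 1))
        (mazurTateElement f p (n + 1)) (Nat.totient (p ^ (n + 1)))
        (mazurTateElement f p (n + 1)).natDegree ≠ 0)
    (h : (Nat.totient (p ^ (n + 1)) : ℤ) * padicValRat p ϖ +
        padicValRat p (Polynomial.resultant
          ((Polynomial.cyclotomic (p ^ (n + 1)) ℚ).comp (Polynomial.X + 1))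
          (mazurTateElement f p (n + 1)) (Nat.totient (p ^ (n + 1)))
          (mazurTateElement f p (n + 1)).natDegree) = V)
    {k : ℕ} (halg : AlgebraicLambdaGE W p k)
    (hkN : ¬ W.HasSplitMultiplicativeReductionAtPrime p → V ≤ k)
    (hkS : W.HasSplitMultiplicativeReductionAtPrime p → V ≤ k + 1) :
    X2.AnalyticMuLE W p 0 ∧
      ∃ n k : ℕ, X2.AnalyticLambdaEq W p n ∧ AlgebraicLambdaGE W p k ∧
        (¬ W.HasSplitMultiplicativeReductionAtPrime p → n ≤ k) ∧
        (W.HasSplitMultiplicativeReductionAtPrime p → n ≤ k + 1) := by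
  obtain ⟨hμ, hlam⟩ := analyticMuLE_zero_and_analyticLambdaEq_of_padicValRat_resultant_eq_of_red hWu
    hpar hp2 hmult hred hf hϖ hV hR h
  exact ⟨hμ, V, k, hlam, halg, hkN, hkS⟩

/-- **Mazur's main conjecture AT THE PAIR from the resultant certificate and an algebraic budget**
(route T at `p ‖ N`, tree `X2.mazurMainConjectureAt_of_algebraicLambdaGE`).
[cite: Wuthrich2014, Thm. 16 (p. 397)] [cite: GreenbergLNM1716, Cor. 5.6 (p. 136)] -/
theorem mazurMainConjectureAt_of_padicValRat_resultant_eq_of_algebraicLambdaGE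
    (hWu : thm16_charIdeal_dvd_multiplicative_of_reducible) (hpar : nonempty_modularParametrizationData)
    (hp2 : p ≠ 2) (hmult : W.HasMultiplicativeReductionAtPrime p)
    (hred : ¬ W.HasIrreducibleModPGaloisRep p) (hf : IsNewformOf W f)
    (hϖ : (ϖ : ℝ) * W.realPeriodRat = plusPeriod f) {n V : ℕ} (hV : V < Nat.totient (p ^ (n + 1)))
    (hR : Polynomial.resultant ((Polynomial.cyclotomic (p ^ (n + 1)) ℚ).comp (Polynomial.X + 1))
        (mazurTateElement f p (n + 1)) (Nat.totient (p ^ (n + 1)))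
        (mazurTateElement f p (n + 1)).natDegree ≠ 0)
    (h : (Nat.totient (p ^ (n + 1)) : ℤ) * padicValRat p ϖ +
        padicValRat p (Polynomial.resultant
          ((Polynomial.cyclotomic (p ^ (n + 1)) ℚ).comp (Polynomial.X + 1))
          (mazurTateElement f p (n + 1)) (Nat.totient (p ^ (n + 1)))
          (mazurTateElement f p (n + 1)).natDegree) = V)
    {k : ℕ} (halg : AlgebraicLambdaGE W p k)
    (hkN : ¬ W.HasSplitMultiplicativeReductionAtPrime p → V ≤ k)
    (hkS : W.HasSplitMultiplicativeReductionAtPrime p → V ≤ k + 1) : X2.MazurMainConjectureAt W p := by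
  obtain ⟨hμ, hlam⟩ := analyticMuLE_zero_and_analyticLambdaEq_of_padicValRat_resultant_eq_of_red hWu
    hpar hp2 hmult hred hf hϖ hV hR h
  exact X2.mazurMainConjectureAt_of_algebraicLambdaGE hWu W p hp2 hmult hred hμ hlam halg hkN hkS

/-- **Slack form** (one algebraic zero fewer, analytic rank `≤ 1`; parity `h310` + `hGZK`, tree
`X2.mazurMainConjectureAt_of_algebraicLambdaGE_of_le`). [cite: GreenbergLNM1716, Prop. 3.10]
[cite: Wuthrich2014, Thm. 16 (p. 397)] -/
theorem mazurMainConjectureAt_of_padicValRat_resultant_eq_of_algebraicLambdaGE_of_le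
    (hWu : thm16_charIdeal_dvd_multiplicative_of_reducible)
    (h310 : prop310_selmerCorank_mod_two_eq_lambdaInvariant)
    (hGZK : rank_eq_analyticRank_of_analyticRank_le_one)
    (hpar : nonempty_modularParametrizationData) (hp2 : p ≠ 2)
    (hmult : W.HasMultiplicativeReductionAtPrime p) (hred : ¬ W.HasIrreducibleModPGaloisRep p)
    (hr : W.analyticRank ≤ 1) (hf : IsNewformOf W f)
    (hϖ : (ϖ : ℝ) * W.realPeriodRat = plusPeriod f) {n V : ℕ} (hV : V < Nat.totient (p ^ (n + 1)))
    (hR : Polynomial.resultant ((Polynomial.cyclotomic (p ^ (n + 1)) ℚ).comp (Polynomial.X + 1))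
        (mazurTateElement f p (n + 1)) (Nat.totient (p ^ (n + 1)))
        (mazurTateElement f p (n + 1)).natDegree ≠ 0)
    (h : (Nat.totient (p ^ (n + 1)) : ℤ) * padicValRat p ϖ +
        padicValRat p (Polynomial.resultant
          ((Polynomial.cyclotomic (p ^ (n + 1)) ℚ).comp (Polynomial.X + 1))
          (mazurTateElement f p (n + 1)) (Nat.totient (p ^ (n + 1)))
          (mazurTateElement f p (n + 1)).natDegree) = V)
    {k : ℕ} (halg : AlgebraicLambdaGE W p k)
    (hkN : ¬ W.HasSplitMultiplicativeReductionAtPrime p → V ≤ k + 1)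
    (hkS : W.HasSplitMultiplicativeReductionAtPrime p → V ≤ k + 2) : X2.MazurMainConjectureAt W p := by
  obtain ⟨hμ, hlam⟩ := analyticMuLE_zero_and_analyticLambdaEq_of_padicValRat_resultant_eq_of_red hWu
    hpar hp2 hmult hred hf hϖ hV hR h
  exact X2.mazurMainConjectureAt_of_algebraicLambdaGE_of_le hWu h310 hGZK hpar W p hp2 hmult hred hr hμ
    hlam halg hkN hkS

/-- **Rank-growth road**: the resultant certificate with value `V`, a rank-growth certificate
`LayerRankGEAt W₀ p k m` (`rank E(ℚ_k) ≥ m`) and `V ≤ m` (non-split) / `V ≤ m + 1` (split) ⟹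
`X2.MazurMainConjectureAt W₀ p` (Greenberg Thm. 1.9 PROVED, binder-free
`Iwasawa.algebraicLambdaGE_of_layerRankGEAt'`; route T). [cite: GreenbergLNM1716, Thm. 1.9 (p. 63)]
[cite: Wuthrich2014, Thm. 16 (p. 397)] -/
theorem mazurMainConjectureAt_of_padicValRat_resultant_eq_of_layerRankGEAt
    (hWu : thm16_charIdeal_dvd_multiplicative_of_reducible) (hpar : nonempty_modularParametrizationData)
    (hp2 : p ≠ 2) (hmult : W.HasMultiplicativeReductionAtPrime p)
    (hred : ¬ W.HasIrreducibleModPGaloisRep p) (hf : IsNewformOf W f)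
    (hϖ : (ϖ : ℝ) * W.realPeriodRat = plusPeriod f) {n V : ℕ} (hV : V < Nat.totient (p ^ (n + 1)))
    (hR : Polynomial.resultant ((Polynomial.cyclotomic (p ^ (n + 1)) ℚ).comp (Polynomial.X + 1))
        (mazurTateElement f p (n + 1)) (Nat.totient (p ^ (n + 1)))
        (mazurTateElement f p (n + 1)).natDegree ≠ 0)
    (h : (Nat.totient (p ^ (n + 1)) : ℤ) * padicValRat p ϖ +
        padicValRat p (Polynomial.resultant
          ((Polynomial.cyclotomic (p ^ (n + 1)) ℚ).comp (Polynomial.X + 1))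
          (mazurTateElement f p (n + 1)) (Nat.totient (p ^ (n + 1)))
          (mazurTateElement f p (n + 1)).natDegree) = V)
    {k m : ℕ} (hm : LayerRankGEAt W p k m)
    (hkN : ¬ W.HasSplitMultiplicativeReductionAtPrime p → V ≤ m)
    (hkS : W.HasSplitMultiplicativeReductionAtPrime p → V ≤ m + 1) : X2.MazurMainConjectureAt W p :=
  mazurMainConjectureAt_of_padicValRat_resultant_eq_of_algebraicLambdaGE hWu hpar hp2 hmult hred hf hϖ
    hV hR h (algebraicLambdaGE_of_layerRankGEAt' (Or.inr hmult) hm) hkN hkS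

/-- **END-TO-END at a type-A SPLIT ÉTALE END from the resultant certificate.** `p` odd
multiplicative, `p ∣ #E(ℚ)_tors(W₀)` (so split and `E[p]` reducible: the étale end of a type-A
class), `S` places `v ∤ p` with `p ∣ c_v(W₀)`, the `padicValRat` resultant certificate of layer
`n + 1` with value `V < φ(pⁿ⁺¹)`, and `V + 2·v_p(#E(ℚ)_tors) ≤ #S + 2` ⟹ `X2.MazurMainConjectureAt W₀ p`
(`λ_an = V` exactly; the trivial zero gives `k = V − 1`, supplied by lam-b p480562
`X2.algebraicLambdaGE_of_dvd_torsionOrder_of_dvd_localTamagawaNumber` from `μ_an ≤ 0`). Named print: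
`hWu`, `hPT`, `h415`, `hpar`. Per pair the inputs are ONE rational determinant and two integers.
[cite: GreenbergLNM1716, §5 pp. 114–118 and Cor. 5.6 (p. 136)] [cite: Wuthrich2014, Thm. 16 (p. 397)]
[cite: MazurTateTeitelbaum1986Invent, §I.13–I.15] -/
theorem X2.mazurMainConjectureAt_of_padicValRat_resultant_eq_of_dvd_torsionOrder_of_dvd_localTamagawaNumber
    (hodd : p ≠ 2) (hPT : poitouTate_selmerStructure_duality ℚ)
    (h415 : prop415ii_noFiniteSubmodule_of_ordinary_or_multiplicative)
    (hWu : thm16_charIdeal_dvd_multiplicative_of_reducible)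
    (hpar : nonempty_modularParametrizationData)
    (hmult : W.HasMultiplicativeReductionAtPrime p) (htors : p ∣ W.torsionOrder)
    (S : Finset (HeightOneSpectrum (𝓞 ℚ))) (hSp : ∀ v ∈ S, ((p : ℕ) : 𝓞 ℚ) ∉ v.asIdeal)
    (hcv : ∀ v ∈ S,
      p ∣ (W.baseChange (v.adicCompletion ℚ)).localTamagawaNumber (v.adicCompletionIntegers ℚ))
    (hf : IsNewformOf W f) (hϖ : (ϖ : ℝ) * W.realPeriodRat = plusPeriod f) {n V : ℕ}
    (hV : V < Nat.totient (p ^ (n + 1)))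
    (hR : Polynomial.resultant ((Polynomial.cyclotomic (p ^ (n + 1)) ℚ).comp (Polynomial.X + 1))
        (mazurTateElement f p (n + 1)) (Nat.totient (p ^ (n + 1)))
        (mazurTateElement f p (n + 1)).natDegree ≠ 0)
    (h : (Nat.totient (p ^ (n + 1)) : ℤ) * padicValRat p ϖ +
        padicValRat p (Polynomial.resultant
          ((Polynomial.cyclotomic (p ^ (n + 1)) ℚ).comp (Polynomial.X + 1))
          (mazurTateElement f p (n + 1)) (Nat.totient (p ^ (n + 1)))
          (mazurTateElement f p (n + 1)).natDegree) = V)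
    (hb : V + 2 * (W.torsionOrder).factorization p ≤ S.card + 2) :
    X2.MazurMainConjectureAt W p := by
  have hred : ¬ W.HasIrreducibleModPGaloisRep p :=
    not_hasIrreducibleModPGaloisRep_of_dvd_torsionOrder W p htors
  have hp3 : 3 ≤ p := by
    have h2 := hp.out.two_le
    omega
  have hsplit : W.HasSplitMultiplicativeReductionAtPrime p :=
    X2.hasSplitMultiplicativeReductionAtPrime_of_dvd_torsionOrder W p hp3 hmult htors
  obtain ⟨hμ, hlam⟩ := analyticMuLE_zero_and_analyticLambdaEq_of_padicValRat_resultant_eq_of_red hWu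
    hpar hodd hmult hred hf hϖ hV hR h
  rcases Nat.eq_zero_or_pos V with rfl | hVpos
  · exact X2.mazurMainConjectureAt_of_algebraicLambdaGE hWu W p hodd hmult hred hμ hlam
      (algebraicLambdaGE_zero W p) (fun _ ↦ le_rfl) (fun _ ↦ Nat.zero_le _)
  · have hb' : (V - 1) + 2 * (W.torsionOrder).factorization p ≤ S.card + 1 := by omega
    have halg : AlgebraicLambdaGE W p (V - 1 - 0) :=
      EisensteinPrimesX2AlgebraicLambdaGESplitTorsion.X2.algebraicLambdaGE_of_dvd_torsionOrder_of_dvd_localTamagawaNumber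
        hodd hPT h415 hWu hpar hmult htors S hSp hcv hμ hb'
    exact X2.mazurMainConjectureAt_of_algebraicLambdaGE hWu W p hodd hmult hred hμ hlam halg
      (fun hns ↦ absurd hsplit hns) (fun _ ↦ by omega)

end AtPair

end Summit.BirchSwinnertonDyer.BirchSwinnertonDyer.Theorems.EisensteinPrimesX2LambdaCountFromResultant

end
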